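import Summits.HubbardSuperconductivity.HubbardSuperconductivity.Theses.LogColdTorus
import Literature.MathematicalPhysics.QuantumLattice.HubbardThermalFermionDecayProofs
import Literature.MathematicalPhysics.QuantumLattice.HubbardLSMFillingProofs
import Literature.MathematicalPhysics.QuantumLattice.FreeFermionTwistedTraceFormula
import Literature.MathematicalPhysics.QuantumLattice.HubbardWave0LiebProofs

/-!
# Route `LogColdTorus`, support `ThermalChargeDephasing` (item `stmt-HubbardSuperconductivity-8813`), part 1: Hastings' estimate, abstract, and the interaction picture in the charge

CHARGE `e` IS THERMALLY DEAD, with constants UNIFORM in the chemical potential: for every `U`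
there are `C, c₀ > 0` such that for all `μ`, all `β ≥ 1`, all sides `L` and all torus sites
`x, y` and spins `σ`, `|⟨c†_{xσ} c_{yσ}⟩_{β,L,U,μ}| ≤ C·exp(-c₀·dist(x,y)/β)`.

The tree PROVES Hastings' bound (M. B. Hastings, PRL 93 (2004) 126402, eq. (1) with
`ξ ≤ max(ξ_C, vβ/π)`) for the Hubbard torus as
`Literature.MathematicalPhysics.QuantumLattice.norm_gibbsState_creation_annihilation_le`, with
constants depending on `(U, μ)` through the Lieb–Robinson rate of `H(1,U) - μN`
(`J = 2 + |U| + 2|μ|`). The item asks for the printed remark that the on-site term `μN` does not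
enter the velocity. This file supplies it:

* `norm_gibbsState_mul_le_of_anticommutator_decay` — Hastings' estimate (10)–(13) made ABSTRACT:
  for any Hermitian `H`, any `A, B` of norm `≤ 1` whose anticommutator vanishes when the
  "separation" `l > 0`, an anticommutator Lieb–Robinson bound
  `‖{τ_{±t}(A), B}‖ ≤ ‖{A,B}‖ + K₁ t e^{κt - l}` gives
  `|⟨AB⟩_β| ≤ (e + C₁(K₁,κ)) e^{-c₀(κ) l/β}`, `c₀ = min(1/4, π/(2κ))` (the proof is the tree's,
  with the model-dependent inputs turned into hypotheses);
* the INTERACTION PICTURE in the charge: `[H(1,U), N] = 0`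
  (`hamiltonian_isHermitian_and_commute_holds`) gives `e^{c(H - μN)} = e^{cH} e^{-cμN}`
  (`Matrix.exp_add_of_commute`), `e^{-itμN}` is the `U(1)` twist `fockTwist` and
  `e^{-itμN} c†_j e^{itμN} = e^{-itμ} c†_j` (`fockTwist_mul_creation_mul`), whence
  `τ^{H-μN}_t(c†_j) = e^{-itμ} τ^{H}_t(c†_j)` (`heisenbergEvolution_hamiltonianWith_creation`) and
  the anticommutator norms — hence the Lieb–Robinson bound
  `norm_anticommutator_hubbardTorus_le` at `μ = 0` — do not see `μ`;
* the item itself (`thermalChargeDephasing_proof`, with `C = C(U, 0)`, `c₀ = c₀(U, 0)`) is assembled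
  in the sibling module `LogColdTorusThermalChargeDephasing`.

Sources: M. B. Hastings, Phys. Rev. Lett. 93 (2004) 126402 = arXiv:cond-mat/0406348, eq. (1),
eqs. (5)–(13) and the paragraph after (13); B. Nachtergaele, R. Sims, CMP 265 (2006) 119;
M. B. Hastings, T. Koma, CMP 265 (2006) 781, App. A.
-/

set_option linter.dupNamespace false

noncomputable section

namespace Summit.HubbardSuperconductivity.HubbardSuperconductivity.Theorems.LogColdTorus

open MeasureTheory Set Filter Matrix Complex Finset
open Literature.MathematicalPhysics.QuantumLattice Literature.Probability.LatticeModels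
open Summit.HubbardSuperconductivity.HubbardSuperconductivity.Theses.LogColdTorus
open scoped Matrix.Norms.L2Operator ComplexOrder

/-! ### Hastings' estimate (10)–(13), abstract form -/

section Abstract

variable {m : Type*} [Fintype m] [DecidableEq m] [Nonempty m]

/-- **Hastings' estimate for a thermal two-point function from an anticommutator Lieb–Robinson
bound** (PRL 93 (2004) 126402, eqs. (10)–(13), abstract form of the tree's
`norm_gibbsState_creation_annihilation_le`). Let `H` be Hermitian, `‖A‖, ‖B‖ ≤ 1`, `l ≥ 0` a
"separation" such that `{A, B} = 0` whenever `l > 0`, `β ≥ 1`, and suppose the anticommutator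
Lieb–Robinson bounds `‖{τ_{t}(A), B}‖ ≤ ‖{A,B}‖ + K₁ t e^{κt - l}`,
`‖{τ_{-t}(A), B}‖ ≤ ‖{B,A}‖ + K₁ t e^{κt - l}` (`t ≥ 0`, `K₁, κ > 0`). Then
`|⟨AB⟩_β| ≤ (e + C₁) e^{-c₀ l/β}`, `C₁ = (K₁/π)(1/2κ)(4/e) + 4/(π(1 - e^{-2}))`,
`c₀ = min(1/4, π/(2κ))`. Proof verbatim the tree's (integral representation
`hastings_integral_representation`, split at `T = l/(2κ)`, kernel bounds, trivial bound when
`πT/β < 1`). [cite: HastingsPRL2004FermiDecay, eqs. (10)–(13)] -/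
theorem norm_gibbsState_mul_le_of_anticommutator_decay {H : Matrix m m ℂ} (hH : H.IsHermitian)
    {A B : Matrix m m ℂ} (hA1 : ‖A‖ ≤ 1) (hB1 : ‖B‖ ≤ 1) {K₁ κ l β : ℝ} (hK₁pos : 0 < K₁)
    (hκpos : 0 < κ) (hl : 0 ≤ l) (hβ : 1 ≤ β) (hAB0 : 0 < l → A * B + B * A = 0)
    (hLRp : ∀ t : ℝ, 0 ≤ t →
      ‖heisenbergEvolution H t A * B + B * heisenbergEvolution H t A‖ ≤
        ‖A * B + B * A‖ + K₁ * t * Real.exp (κ * t - l))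
    (hLRn : ∀ t : ℝ, 0 ≤ t →
      ‖heisenbergEvolution H (-t) A * B + B * heisenbergEvolution H (-t) A‖ ≤
        ‖B * A + A * B‖ + K₁ * t * Real.exp (κ * t - l)) :
    ‖gibbsState β H (A * B)‖ ≤
      (Real.exp 1 + (K₁ / Real.pi * (1 / (2 * κ)) * (4 / Real.exp 1) +
          4 / (Real.pi * (1 - Real.exp (-2))))) *
        Real.exp (-(min (1 / 4 : ℝ) (Real.pi / (2 * κ)) * l / β)) := by
  set c₀ : ℝ := min (1 / 4 : ℝ) (Real.pi / (2 * κ)) with hc₀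
  set C₁ : ℝ := K₁ / Real.pi * (1 / (2 * κ)) * (4 / Real.exp 1) +
    4 / (Real.pi * (1 - Real.exp (-2))) with hC₁
  change ‖gibbsState β H (A * B)‖ ≤ (Real.exp 1 + C₁) * Real.exp (-(c₀ * l / β))
  have hπ : Real.pi ≠ 0 := Real.pi_ne_zero
  have he2 : 0 < 1 - Real.exp (-2) := by
    have := Real.exp_lt_one_iff.2 (by norm_num : (-2 : ℝ) < 0); linarith
  have hc₀pos : 0 < c₀ := lt_min (by norm_num) (by positivity)
  have hc₀_le_quarter : c₀ ≤ 1 / 4 := min_le_left _ _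
  have hc₀_le : c₀ ≤ Real.pi / (2 * κ) := min_le_right _ _
  have hC₁nn : 0 ≤ C₁ := by positivity
  have hβpos : 0 < β := by linarith
  -- the trivial bound `|⟨AB⟩| ≤ ‖A‖ ‖B‖ ≤ 1`
  have htriv : ‖gibbsState β H (A * B)‖ ≤ 1 :=
    (norm_gibbsState_le hH β _).trans ((norm_mul_le _ _).trans (mul_le_one₀ hA1 (norm_nonneg _) hB1))
  set a : ℝ := Real.pi / β with ha_def
  have ha : 0 < a := div_pos Real.pi_pos hβpos
  by_cases hcase : a * (l / (2 * κ)) < 1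
  · -- separations `l < 2κβ/π`: the trivial bound suffices
    have h1 : c₀ * l / β ≤ 1 := by
      calc c₀ * l / β ≤ Real.pi / (2 * κ) * l / β := by gcongr
        _ = a * (l / (2 * κ)) := by rw [ha_def]; ring
        _ ≤ 1 := hcase.le
    calc ‖gibbsState β H (A * B)‖ ≤ 1 := htriv
      _ = Real.exp 1 * Real.exp (-1) := by rw [← Real.exp_add]; norm_num
      _ ≤ (Real.exp 1 + C₁) * Real.exp (-(c₀ * l / β)) :=
          mul_le_mul (by linarith) (Real.exp_le_exp.2 (by linarith)) (Real.exp_pos _).le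
            (by positivity)
  -- separations `l ≥ 2κβ/π`: Hastings' argument
  have haT : 1 ≤ a * (l / (2 * κ)) := not_lt.1 hcase
  set T : ℝ := l / (2 * κ) with hT_def
  have hT : 0 < T := lt_of_mul_lt_mul_left (by linarith : a * 0 < a * T) ha.le
  have hκT : κ * T = l / 2 := by rw [hT_def]; field_simp
  have hl0 : 0 < l := by
    rcases hl.eq_or_lt with h | h
    · exfalso
      rw [← h, zero_div] at hT_def
      rw [hT_def] at hT
      exact lt_irrefl _ hT
    · exact h
  -- `{A, B} = 0` beyond the trivial regime
  have hAB : A * B + B * A = 0 := hAB0 hl0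
  have hBA : B * A + A * B = 0 := by rw [add_comm]; exact hAB
  -- Hastings' integral representation, eq. (9)
  obtain ⟨hInt, hrep⟩ := hastings_integral_representation hH hβpos A B
  set K : ℝ → ℝ := fun t => Real.exp (-(a * t)) / (1 - Real.exp (-(2 * (a * t)))) with hK
  set g : ℝ → ℂ := fun t =>
    (gibbsWeight β H * (heisenbergEvolution H t A * B + B * heisenbergEvolution H t A)).trace with hg
  have hInt' : MeasureTheory.IntegrableOn (fun t : ℝ => (K t : ℂ) * (g t - g (-t))) (Set.Ioi 0) := hInt
  have hrep' : (gibbsWeight β H * (A * B)).trace =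
      I / β * ∫ t in Set.Ioi (0 : ℝ), (K t : ℂ) * (g t - g (-t)) := by
    rw [hrep, hAB, Matrix.mul_zero, Matrix.trace_zero, mul_zero, zero_add]
  -- normalisation by `Z > 0`
  have hZ : partitionFn β H = ((partitionFn β H).re : ℂ) := partitionFn_eq_re hH β
  have hZpos : 0 < (partitionFn β H).re := partitionFn_re_pos hH β
  set Z : ℝ := (partitionFn β H).re with hZ_def
  set G : ℝ → ℂ := fun t =>
    gibbsState β H (heisenbergEvolution H t A * B + B * heisenbergEvolution H t A) with hG
  have hGg : ∀ t, G t = (Z : ℂ)⁻¹ * g t := by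
    intro t
    simp only [hG, hg]
    rw [gibbsState_apply, hZ]
  have hGS : gibbsState β H (A * B) = I / β * ∫ t in Set.Ioi (0 : ℝ), (K t : ℂ) * (G t - G (-t)) := by
    rw [gibbsState_apply, hrep', hZ, ← mul_assoc, mul_comm ((Z : ℂ)⁻¹) (I / β), mul_assoc,
      ← MeasureTheory.integral_const_mul]
    congr 1
    refine MeasureTheory.setIntegral_congr_fun measurableSet_Ioi fun t _ => ?_
    rw [hGg t, hGg (-t)]
    ring
  -- pointwise bounds
  have hGle : ∀ t, ‖G t‖ ≤ ‖heisenbergEvolution H t A * B + B * heisenbergEvolution H t A‖ :=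
    fun t => norm_gibbsState_le hH β _
  have hanti_triv : ∀ t, ‖heisenbergEvolution H t A * B + B * heisenbergEvolution H t A‖ ≤ 2 := by
    intro t
    calc _ ≤ ‖heisenbergEvolution H t A * B‖ + ‖B * heisenbergEvolution H t A‖ := norm_add_le _ _
      _ ≤ ‖heisenbergEvolution H t A‖ * ‖B‖ + ‖B‖ * ‖heisenbergEvolution H t A‖ :=
          add_le_add (norm_mul_le _ _) (norm_mul_le _ _)
      _ ≤ 1 * 1 + 1 * 1 := by
          rw [norm_heisenbergEvolution_holds hH]
          gcongr
      _ = 2 := by norm_num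
  have hLRpos : ∀ t, 0 ≤ t →
      ‖heisenbergEvolution H t A * B + B * heisenbergEvolution H t A‖ ≤ K₁ * t * Real.exp (κ * t - l) := by
    intro t ht
    have h := hLRp t ht
    rwa [hAB, norm_zero, zero_add] at h
  have hLRneg : ∀ t, 0 ≤ t →
      ‖heisenbergEvolution H (-t) A * B + B * heisenbergEvolution H (-t) A‖ ≤
        K₁ * t * Real.exp (κ * t - l) := by
    intro t ht
    have h := hLRn t ht
    rwa [hBA, norm_zero, zero_add] at h
  set F : ℝ → ℂ := fun t => (K t : ℂ) * (G t - G (-t)) with hF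
  have hFnorm : ∀ t, 0 < t → ‖F t‖ ≤ K t *
      (‖heisenbergEvolution H t A * B + B * heisenbergEvolution H t A‖ +
        ‖heisenbergEvolution H (-t) A * B + B * heisenbergEvolution H (-t) A‖) := by
    intro t ht
    have hKt : 0 ≤ K t := (matsubaraKernel_pos (mul_pos ha ht)).le
    calc ‖F t‖ = |K t| * ‖G t - G (-t)‖ := by
          simp only [hF, norm_mul, Complex.norm_real, Real.norm_eq_abs]
      _ ≤ K t * (‖G t‖ + ‖G (-t)‖) := by
          rw [abs_of_nonneg hKt]
          exact mul_le_mul_of_nonneg_left (norm_sub_le _ _) hKt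
      _ ≤ _ := mul_le_mul_of_nonneg_left (add_le_add (hGle t) (hGle (-t))) hKt
  -- times `t ≤ c₁ l`: `k(t) ≤ β/(2πt)` and the Lieb–Robinson bound
  have hsmall : ∀ t ∈ Set.Ioc (0 : ℝ) T, ‖F t‖ ≤ K₁ / a * Real.exp (-l / 2) := by
    intro t ht
    obtain ⟨ht0, htT⟩ := ht
    have ht0' : t ≠ 0 := ht0.ne'
    have hKt := matsubaraKernel_le_inv (mul_pos ha ht0)
    refine (hFnorm t ht0).trans ?_
    calc K t * (‖heisenbergEvolution H t A * B + B * heisenbergEvolution H t A‖ +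
          ‖heisenbergEvolution H (-t) A * B + B * heisenbergEvolution H (-t) A‖)
        ≤ 1 / (2 * (a * t)) * (K₁ * t * Real.exp (κ * t - l) + K₁ * t * Real.exp (κ * t - l)) :=
          mul_le_mul hKt (add_le_add (hLRpos t ht0.le) (hLRneg t ht0.le)) (by positivity)
            (by positivity)
      _ = K₁ / a * Real.exp (κ * t - l) := by field_simp; norm_num
      _ ≤ K₁ / a * Real.exp (-l / 2) := by
          have : κ * t ≤ κ * T := mul_le_mul_of_nonneg_left htT hκpos.le
          gcongr
          linarith
  -- times `t > c₁ l`: `‖{A(±t), B}‖ ≤ 2` and `k(t) ≤ e^{-πt/β}/(1 - e^{-2})`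
  have hlarge : ∀ t ∈ Set.Ioi T, ‖F t‖ ≤ 4 / (1 - Real.exp (-2)) * Real.exp (-(a * t)) := by
    intro t ht
    have ht' : T < t := ht
    have ht0 : 0 < t := hT.trans ht'
    have hk1 : K t ≤ Real.exp (-(a * t)) / (1 - Real.exp (-(2 * (a * T)))) :=
      matsubaraKernel_le_exp_div (mul_pos ha hT) (by nlinarith)
    have hk2 : Real.exp (-(a * t)) / (1 - Real.exp (-(2 * (a * T)))) ≤
        Real.exp (-(a * t)) / (1 - Real.exp (-2)) := by
      refine div_le_div_of_nonneg_left (Real.exp_pos _).le he2 ?_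
      have : Real.exp (-(2 * (a * T))) ≤ Real.exp (-2) := Real.exp_le_exp.2 (by nlinarith)
      linarith
    refine (hFnorm t ht0).trans ?_
    calc K t * (‖heisenbergEvolution H t A * B + B * heisenbergEvolution H t A‖ +
          ‖heisenbergEvolution H (-t) A * B + B * heisenbergEvolution H (-t) A‖)
        ≤ K t * (2 + 2) := mul_le_mul_of_nonneg_left (add_le_add (hanti_triv t) (hanti_triv (-t)))
            (matsubaraKernel_pos (mul_pos ha ht0)).le
      _ ≤ Real.exp (-(a * t)) / (1 - Real.exp (-2)) * (2 + 2) :=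
          mul_le_mul_of_nonneg_right (hk1.trans hk2) (by norm_num)
      _ = 4 / (1 - Real.exp (-2)) * Real.exp (-(a * t)) := by ring
  -- integrability of `F` and Hastings' split `∫₀^∞ = ∫₀^T + ∫_T^∞`
  have hFint : MeasureTheory.IntegrableOn F (Set.Ioi 0) := by
    have h := hInt'.const_mul ((Z : ℂ)⁻¹)
    refine MeasureTheory.IntegrableOn.congr_fun h (fun t _ => ?_) measurableSet_Ioi
    simp only [hF, hGg]
    ring
  have hI := norm_integral_Ioi_le_of_split ha hT hFint hsmall hlarge
  -- the two exponentials against `e^{-c₀ l/β}`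
  have hexp1 : Real.exp (-l / 2) * T ≤ 1 / (2 * κ) * (4 / Real.exp 1) * Real.exp (-(c₀ * l / β)) := by
    have hl' : (0 : ℝ) ≤ l := hl
    have h1 := mul_exp_neg_half_le l
    have h2 : Real.exp (-l / 4) ≤ Real.exp (-(c₀ * l / β)) := by
      rw [Real.exp_le_exp]
      have h3 : c₀ * l / β ≤ c₀ * l / 1 :=
        div_le_div_of_nonneg_left (by positivity) one_pos hβ
      have h4 : c₀ * l ≤ 1 / 4 * l := mul_le_mul_of_nonneg_right hc₀_le_quarter hl'
      linarith
    calc Real.exp (-l / 2) * T = 1 / (2 * κ) * (l * Real.exp (-l / 2)) := by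
          rw [hT_def]; ring
      _ ≤ 1 / (2 * κ) * (4 / Real.exp 1 * Real.exp (-l / 4)) := by gcongr
      _ ≤ 1 / (2 * κ) * (4 / Real.exp 1 * Real.exp (-(c₀ * l / β))) := by gcongr
      _ = _ := by ring
  have hexp2 : Real.exp (-(a * T)) ≤ Real.exp (-(c₀ * l / β)) := by
    rw [Real.exp_le_exp, neg_le_neg_iff]
    have : a * T = Real.pi / (2 * κ) * l / β := by rw [ha_def, hT_def]; ring
    rw [this]
    exact div_le_div_of_nonneg_right (mul_le_mul_of_nonneg_right hc₀_le (hl)) hβpos.le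
  have hnormI : ‖I / (β : ℂ)‖ = 1 / β := by
    rw [norm_div, Complex.norm_I, Complex.norm_real, Real.norm_of_nonneg hβpos.le]
  calc ‖gibbsState β H (A * B)‖ = ‖I / (β : ℂ)‖ * ‖∫ t in Set.Ioi (0 : ℝ), F t‖ := by
        rw [hGS, norm_mul]
    _ ≤ 1 / β * (K₁ / a * Real.exp (-l / 2) * T +
          4 / (1 - Real.exp (-2)) * (Real.exp (-(a * T)) / a)) := by
        rw [hnormI]
        exact mul_le_mul_of_nonneg_left hI (by positivity)
    _ = K₁ / Real.pi * (Real.exp (-l / 2) * T) +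
          4 / (Real.pi * (1 - Real.exp (-2))) * Real.exp (-(a * T)) := by
        have hβ0 : β ≠ 0 := hβpos.ne'
        have he20 : 1 - Real.exp (-2) ≠ 0 := he2.ne'
        rw [ha_def]
        field_simp
    _ ≤ K₁ / Real.pi * (1 / (2 * κ) * (4 / Real.exp 1) * Real.exp (-(c₀ * l / β))) +
          4 / (Real.pi * (1 - Real.exp (-2))) * Real.exp (-(c₀ * l / β)) := by
        gcongr
    _ = C₁ * Real.exp (-(c₀ * l / β)) := by rw [hC₁]; ring
    _ ≤ (Real.exp 1 + C₁) * Real.exp (-(c₀ * l / β)) := by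
        gcongr
        linarith [Real.exp_pos (1 : ℝ)]

end Abstract

/-! ### The interaction picture in the charge: `μ N` drops out of the dynamics of `c†`, `c` -/

section Gauge

variable {Λ : Type*} [LinearOrder Λ] [Fintype Λ] (G : SimpleGraph Λ) [DecidableRel G.Adj]

/-- The `U(1)` gauge group generated by `N`: `e^{iaN}` is the occupation-diagonal twist
`fockTwist (fun _ => a)`. [folklore] -/
theorem exp_smul_totalNumber_eq_fockTwist (a : ℝ) :
    NormedSpace.exp (((a : ℂ) * I) • (totalNumber : Matrix (Finset (Orb Λ)) (Finset (Orb Λ)) ℂ)) =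
      fockTwist (fun _ : Orb Λ => a) := by
  rw [← totalNumberOp_eq_totalNumber, exp_smul_totalNumberOp_eq_diagonal, fockTwist_eq]
  congr 1
  funext s
  congr 1
  rw [Finset.sum_const, nsmul_eq_mul]
  push_cast
  ring

/-- **Interaction picture in the charge**: since `[H(t,U), N] = 0`
(`hamiltonian_isHermitian_and_commute_holds`), the Heisenberg evolution of any observable under
`H(t,U) - μN` is the evolution under `H(t,U)` of its `U(1)`-twist by the angle `-sμ`:
`τ^{H-μN}_s(X) = τ^{H}_s(e^{-isμN} X e^{isμN})` (`e^{c(H-μN)} = e^{cH}e^{-cμN}`,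
`Matrix.exp_add_of_commute`). Hastings (2004), remark after eq. (13) ("on-site terms do not enter
the velocity"). [cite: HastingsPRL2004FermiDecay, paragraph after eq. (13)] -/
theorem heisenbergEvolution_hamiltonianWith_eq (t U μ s : ℝ)
    (X : Matrix (Finset (Orb Λ)) (Finset (Orb Λ)) ℂ) :
    heisenbergEvolution (hamiltonianWith G t U μ) s X =
      heisenbergEvolution (hamiltonian G t U) s
        (fockTwist (fun _ : Orb Λ => -(s * μ)) * X * fockTwist (-(fun _ : Orb Λ => -(s * μ)))) := by
  have hHN : Commute (hamiltonian G t U) totalNumber :=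
    ((hamiltonian_isHermitian_and_commute_holds G) t U).2.1
  set N : Matrix (Finset (Orb Λ)) (Finset (Orb Λ)) ℂ := totalNumber with hN
  -- the two factorizations `e^{c(H-μN)} = e^{cH} e^{-cμN}` and `e^{-c(H-μN)} = e^{cμN} e^{-cH}`
  have h1 : NormedSpace.exp ((I * s) • hamiltonianWith G t U μ) =
      NormedSpace.exp ((I * s) • hamiltonian G t U) *
        NormedSpace.exp ((((-(s * μ) : ℝ) : ℂ) * I) • N) := by
    have hc : Commute ((I * (s : ℂ)) • hamiltonian G t U) ((-(I * (s : ℂ) * (μ : ℂ))) • N) :=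
      (hHN.smul_left _).smul_right _
    rw [hamiltonianWith_eq, ← hN, smul_sub, smul_smul, sub_eq_add_neg, ← neg_smul,
      Matrix.exp_add_of_commute _ _ hc]
    congr 3
    push_cast
    ring
  have h2 : NormedSpace.exp ((-(I * s)) • hamiltonianWith G t U μ) =
      NormedSpace.exp ((((s * μ : ℝ) : ℂ) * I) • N) *
        NormedSpace.exp ((-(I * s)) • hamiltonian G t U) := by
    have hc : Commute ((-(-(I * (s : ℂ)) * (μ : ℂ))) • N) ((-(I * (s : ℂ))) • hamiltonian G t U) :=
      (hHN.symm.smul_left _).smul_right _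
    rw [hamiltonianWith_eq, ← hN, smul_sub, smul_smul, sub_eq_add_neg, ← neg_smul, add_comm,
      Matrix.exp_add_of_commute _ _ hc]
    congr 3
    push_cast
    ring
  have hneg : (-(fun _ : Orb Λ => -(s * μ))) = fun _ => s * μ := by
    funext i
    simp
  unfold heisenbergEvolution
  rw [h1, h2, hN, exp_smul_totalNumber_eq_fockTwist, exp_smul_totalNumber_eq_fockTwist, hneg]
  noncomm_ring

/-- `τ^{H-μN}_s(c†_j) = e^{-isμ} τ^{H}_s(c†_j)`. [cite: HastingsPRL2004FermiDecay, paragraph after eq. (13)] -/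
theorem heisenbergEvolution_hamiltonianWith_creation (t U μ s : ℝ) (j : Orb Λ) :
    heisenbergEvolution (hamiltonianWith G t U μ) s (creation j) =
      cexp ((((-(s * μ) : ℝ)) : ℂ) * I) • heisenbergEvolution (hamiltonian G t U) s (creation j) := by
  rw [heisenbergEvolution_hamiltonianWith_eq, fockTwist_mul_creation_mul]
  unfold heisenbergEvolution
  rw [Matrix.mul_smul, Matrix.smul_mul]

/-- `τ^{H-μN}_s(c_j) = e^{isμ} τ^{H}_s(c_j)`. [cite: HastingsPRL2004FermiDecay, paragraph after eq. (13)] -/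
theorem heisenbergEvolution_hamiltonianWith_annihilation (t U μ s : ℝ) (j : Orb Λ) :
    heisenbergEvolution (hamiltonianWith G t U μ) s (annihilation j) =
      cexp ((((s * μ) : ℝ) : ℂ) * I) • heisenbergEvolution (hamiltonian G t U) s (annihilation j) := by
  rw [heisenbergEvolution_hamiltonianWith_eq, fockTwist_mul_annihilation_mul]
  unfold heisenbergEvolution
  rw [Matrix.mul_smul, Matrix.smul_mul]
  congr 2
  push_cast
  ring

omit [LinearOrder Λ] [Fintype Λ] [DecidableRel G.Adj] in
/-- Anticommutators with a phase pulled out: `‖{c • X, B}‖ = ‖c‖ ‖{X, B}‖`. [folklore] -/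
theorem norm_smul_anticommutator {n : Type*} [Fintype n] [DecidableEq n] (c : ℂ) (X B : Matrix n n ℂ) :
    ‖c • X * B + B * (c • X)‖ = ‖c‖ * ‖X * B + B * X‖ := by
  rw [Matrix.smul_mul, Matrix.mul_smul, ← smul_add, norm_smul]

end Gauge

end Summit.HubbardSuperconductivity.HubbardSuperconductivity.Theorems.LogColdTorus
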